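import Literature.Geometry.Riemannian.UniformlyNormalNeighbourhoods
import Literature.Geometry.Lorentzian.GeodesicConfinement
import Mathlib.Topology.Homotopy.Basic
import HarnessLib

/-!
# The tubular neighbourhood of the diagonal given by the exponential map

J. Milnor, J. Stasheff, *Characteristic Classes* (1974), §11, Thm. 11.1 and Lemma 11.5 / Cor. 11.6:
the normal bundle of the diagonal `Δ ⊂ M × M` is isomorphic to the tangent bundle `TM`, and `Δ` has
a tubular neighbourhood; concretely (J. M. Lee, *Introduction to Riemannian Manifolds* (2018),
Prop. 5.19 (e) and Lemma 6.16: the map `E(v) = (π v, exp v)` is a diffeomorphism from a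
neighbourhood of the zero section of `TM` onto a neighbourhood of the diagonal).  For a smooth
Riemannian metric on a COMPACT Hausdorff manifold over a boundaryless model we prove:

* `continuous_smul_totalSpace` — `(t, v) ↦ t • v` is continuous on the total space of a real
  vector bundle (used for the fibrewise contraction of `TM`);
* `continuous_expMap_totalSpace_of_compactSpace` — `v ↦ exp v` is continuous on all of `TM`
  (compact ⇒ geodesically complete, Hopf–Rinow; `exp` is smooth on its open domain);
* `homotopic_proj_expMap` — **`π ≃ exp : TM → M`** through `(t, v) ↦ exp(t v)`;
* **`exists_expPair_openPartialHomeomorph`** — there is an `OpenPartialHomeomorph` `e` from `TM` to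
  `M × M` which IS `v ↦ (π v, exp v)`, whose (open) source contains the zero section and is
  fibrewise star-shaped, and on whose source `exp v = π v ↔ v = 0` (so `e` identifies
  (source, source ∖ zero section) with (target, target ∖ Δ), target an open neighbourhood of `Δ`).
  Proof: with the uniform normal radius `ε` of `exists_uniform_normalRadius` (Lee, Lemma 6.16) the
  map is injective on the compact tube `{g(v,v) ≤ (ε/2)²}` (`exp_q` is injective on the `ε`-ball),
  hence a closed embedding there (compact-to-Hausdorff); its restriction to the open tube
  `{g(v,v) < (ε/2)²}` has open image `{d(q, x) < ε/2}` (geodesic balls are metric balls,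
  Cor. 6.13), so it is an open embedding.

Everything is proved; no definitions, no named facts (D-0026).  Written for Wu's formula on
almost complex `4`-manifolds (the diagonal class `u' ∈ Hⁿ(M × M, M × M ∖ Δ)`, Milnor–Stasheff §11).

## References

* J. Milnor, J. Stasheff, *Characteristic Classes*, Ann. of Math. Stud. 76 (1974), §11 Thm. 11.1,
  Lemma 11.5, Cor. 11.6. [MilnorStasheff1974]
* J. M. Lee, *Introduction to Riemannian Manifolds*, 2nd ed., GTM 176 (2018), Prop. 5.19 (e),
  Lemma 6.16, Cor. 6.13. [LeeRiemannianManifolds2018]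
-/

noncomputable section

open Bundle Set Filter Function Metric Manifold Topology
open scoped Manifold ContDiff Topology ENNReal NNReal

namespace Literature.Geometry.Riemannian

open Literature.Geometry.Lorentzian
open Literature.Geometry.Lorentzian.PseudoRiemannianMetric

/-! ### Scalar multiplication on the total space of a vector bundle is continuous -/

section SMul

variable {B F : Type*} [TopologicalSpace B] [NormedAddCommGroup F] [NormedSpace ℝ F]
  {V : B → Type*} [TopologicalSpace (TotalSpace F V)] [∀ b, TopologicalSpace (V b)]
  [∀ b, AddCommGroup (V b)] [∀ b, Module ℝ (V b)] [FiberBundle F V] [VectorBundle ℝ F V]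

/-- **`(t, v) ↦ t • v` is continuous on the total space of a real vector bundle**: in the
trivialisation at `π v₀` the fibre coordinate is multiplied by `t` (fibrewise linearity).
[folklore] -/
theorem continuous_smul_totalSpace :
    Continuous fun q : ℝ × TotalSpace F V ↦ TotalSpace.mk' F q.2.proj (q.1 • q.2.2) := by
  refine continuous_iff_continuousAt.2 fun q₀ ↦ ?_
  rw [FiberBundle.continuousAt_totalSpace]
  refine ⟨((FiberBundle.continuous_proj F V).comp continuous_snd).continuousAt, ?_⟩
  set e := trivializationAt F V q₀.2.proj with he
  have hmem : ∀ᶠ q : ℝ × TotalSpace F V in 𝓝 q₀, q.2.proj ∈ e.baseSet :=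
    ((FiberBundle.continuous_proj F V).comp continuous_snd).continuousAt.preimage_mem_nhds
      (e.open_baseSet.mem_nhds (FiberBundle.mem_baseSet_trivializationAt F V q₀.2.proj))
  have heq : (fun q : ℝ × TotalSpace F V ↦ (e (TotalSpace.mk' F q.2.proj (q.1 • q.2.2))).2) =ᶠ[𝓝 q₀]
      fun q ↦ q.1 • (e q.2).2 := by
    filter_upwards [hmem] with q hq
    exact (e.linear ℝ hq).map_smul q.1 q.2.2
  rw [continuousAt_congr heq]
  exact continuousAt_fst.smul (((continuous_snd.continuousAt).comp
    (e.continuousAt (FiberBundle.mem_trivializationAt_proj_source))).comp continuousAt_snd)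

end SMul

/-! ### `exp` on the tangent bundle of a compact manifold -/

section Compact

variable {E : Type*} [NormedAddCommGroup E] [NormedSpace ℝ E] {H : Type*} [TopologicalSpace H]
  {I : ModelWithCorners ℝ E H} {M : Type*} [TopologicalSpace M] [ChartedSpace H M]
  [IsManifold I ∞ M] {n : ℕ∞ω} [FiniteDimensional ℝ E] [CompleteSpace E] [T2Space M] [I.Boundaryless]
  (g : PseudoRiemannianMetric I n E (TangentSpace I : M → Type _)) [g.HasLeviCivita]
  [CovariantDerivative.ContMDiffCovariantDerivative g.leviCivita 1]

/-- **`exp : TM → M` is continuous on a compact manifold** (compact ⇒ geodesically complete by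
Hopf–Rinow, `hopfRinow_compact_geodesicallyComplete`; `exp` is `C^∞` on its domain, which is then
all of `TM`, `contMDiffOn_expMap_totalSpace`). [cite: LeeRiemannianManifolds2018, Prop. 5.19 (a)] -/
theorem continuous_expMap_totalSpace_of_compactSpace [CompactSpace M] (hn : (∞ : ℕ∞ω) ≤ n)
    (hg : g.IsRiemannian) :
    Continuous fun v : TangentBundle I M ↦ expMap g.leviCivita v.proj v.2 := by
  haveI : Fact (1 ≤ n) := ⟨le_trans (by exact_mod_cast le_top) hn⟩
  haveI := contMDiffCovariantDerivative_leviCivita_infty g hn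
  have hc : IsGeodesicallyComplete g.leviCivita := hopfRinow_compact_geodesicallyComplete hn hg
  have h := contMDiffOn_expMap_totalSpace (cov := g.leviCivita) (k := (⊤ : ℕ∞)) le_top
  have hu : {w : TangentBundle I M | (1 : ℝ) ∈ maximalGeodesicDomain g.leviCivita w.proj w.2} = univ :=
    eq_univ_of_forall fun w ↦ by
      show (1 : ℝ) ∈ maximalGeodesicDomain g.leviCivita w.proj w.2
      rw [(maximalGeodesic_of_isGeodesicallyComplete hc w.proj w.2).1]
      exact mem_univ _
  rw [hu] at h
  exact (contMDiffOn_univ.1 h).continuous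

/-- **`π ≃ exp : TM → M`** through `(t, v) ↦ exp(t v)` (`exp(0_q) = q`). [cite: MilnorStasheff1974, §11 Lemma 11.5] -/
theorem homotopic_proj_expMap [CompactSpace M] (hn : (∞ : ℕ∞ω) ≤ n) (hg : g.IsRiemannian) :
    (⟨TotalSpace.proj, FiberBundle.continuous_proj E (TangentSpace I : M → Type _)⟩ : C(TangentBundle I M, M)).Homotopic
      ⟨fun v : TangentBundle I M ↦ expMap g.leviCivita v.proj v.2,
        continuous_expMap_totalSpace_of_compactSpace g hn hg⟩ := by
  have hex := continuous_expMap_totalSpace_of_compactSpace g hn hg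
  refine ⟨{ toFun := fun q : unitInterval × TangentBundle I M ↦
              expMap g.leviCivita q.2.proj ((q.1 : ℝ) • q.2.2)
            continuous_toFun := ?_
            map_zero_left := fun v ↦ ?_
            map_one_left := fun v ↦ ?_ }⟩
  · have hsm : Continuous fun q : unitInterval × TangentBundle I M ↦
        (TotalSpace.mk' E q.2.proj ((q.1 : ℝ) • q.2.2) : TangentBundle I M) :=
      (continuous_smul_totalSpace (F := E) (V := (TangentSpace I : M → Type _))).comp
        ((continuous_subtype_val.comp continuous_fst).prodMk continuous_snd)
    exact hex.comp hsm
  · show expMap g.leviCivita v.proj ((0 : ℝ) • v.2) = v.proj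
    rw [zero_smul]
    exact expMap_zero (cov := g.leviCivita) v.proj
  · show expMap g.leviCivita v.proj ((1 : ℝ) • v.2) = expMap g.leviCivita v.proj v.2
    rw [one_smul]

/-- **The tubular neighbourhood of the diagonal** (Milnor–Stasheff Thm. 11.1 / Cor. 11.6 for `Δ`;
Lee 2018, Prop. 5.19 (e), Lemma 6.16).  On a compact manifold with a smooth Riemannian metric there
is an open partial homeomorphism `e : TM ⇀ M × M` with `e v = (π v, exp v)`, whose source is an open
neighbourhood of the zero section, fibrewise star-shaped, on which `exp v = π v` only for `v = 0`;
its target is then an open neighbourhood of the diagonal, and `e` restricts to a homeomorphism of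
pairs (source, source ∖ 0) ≅ (target, target ∖ Δ).  Proof: `ε` a uniform normal radius
(`exists_uniform_normalRadius`): `v ↦ (π v, exp v)` is injective on the compact tube
`{g(v, v) ≤ (ε/2)²}`, so a closed embedding there; on the open tube `{g(v, v) < (ε/2)²}` its image is
the open set `{d(q, x) < ε/2}`, so it is an open embedding. [cite: MilnorStasheff1974, §11 Thm. 11.1 and Cor. 11.6]
[cite: LeeRiemannianManifolds2018, Prop. 5.19 (e) and Lemma 6.16] -/
theorem exists_expPair_openPartialHomeomorph [CompactSpace M] [Nonempty M] (hn : (∞ : ℕ∞ω) ≤ n)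
    (hg : g.IsRiemannian) :
    ∃ e : OpenPartialHomeomorph (TangentBundle I M) (M × M),
      (∀ v, e v = (v.proj, expMap g.leviCivita v.proj v.2)) ∧
      (∀ x : M, (⟨x, 0⟩ : TangentBundle I M) ∈ e.source) ∧
      (∀ v ∈ e.source, expMap g.leviCivita v.proj v.2 = v.proj ↔ v.2 = 0) ∧
      (∀ v ∈ e.source, ∀ t : ℝ, |t| ≤ 1 → (⟨v.proj, t • v.2⟩ : TangentBundle I M) ∈ e.source) := by
  haveI : Nonempty (TangentBundle I M) := ⟨⟨Classical.arbitrary M, 0⟩⟩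
  haveI : LocallyCompactSpace M := Manifold.locallyCompact_of_finiteDimensional I
  obtain ⟨ε, hε, hP⟩ := exists_uniform_normalRadius g hn hg
  set cov := g.leviCivita with hcov
  set G : TangentBundle I M → M × M := fun v ↦ (v.proj, expMap cov v.proj v.2) with hG
  have hGc : Continuous G :=
    (FiberBundle.continuous_proj E (TangentSpace I : M → Type _)).prodMk
      (continuous_expMap_totalSpace_of_compactSpace g hn hg)
  set δ : ℝ := ε / 2 with hδ
  have hδpos : 0 < δ := by positivity
  have hδε : δ < ε := by rw [hδ]; linarith
  have hδε2 : δ ^ 2 < ε ^ 2 := pow_lt_pow_left₀ hδε hδpos.le two_ne_zero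
  set A : Set (TangentBundle I M) := {v | g.val v.proj v.2 v.2 < δ ^ 2} with hA
  set K : Set (TangentBundle I M) := {v | g.val v.proj v.2 v.2 ≤ δ ^ 2} with hK
  have hAo : IsOpen A := isOpen_lt g.continuous_val_tangentBundle continuous_const
  have hAK : A ⊆ K := fun v hv ↦ show g.val v.proj v.2 v.2 ≤ δ ^ 2 from le_of_lt hv
  have hKc : IsCompact K := by
    obtain ⟨𝒦, h𝒦, h𝒦S⟩ := g.exists_isCompact_tangent_superset (fun x v hv ↦ hg x v hv) isCompact_univ (δ ^ 2)
    exact h𝒦.of_isClosed_subset (isClosed_le g.continuous_val_tangentBundle continuous_const)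
      fun v hv ↦ h𝒦S v (mem_univ _) hv
  -- distance along `exp` of short vectors
  have hdist : ∀ v : TangentBundle I M, g.val v.proj v.2 v.2 < ε ^ 2 →
      g.edist hg v.proj (expMap cov v.proj v.2) = ENNReal.ofReal (Real.sqrt (g.val v.proj v.2 v.2)) :=
    fun v hv ↦ (hP v.proj).1 v.2 hv
  -- injectivity on `K`
  have hinjK : InjOn G K := by
    rintro ⟨q, v⟩ hv ⟨q', w⟩ hw h
    obtain ⟨hq, h2⟩ := Prod.mk.inj h
    subst hq
    have hv' : g.val q v v < ε ^ 2 := lt_of_le_of_lt hv hδε2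
    have hw' : g.val q w w < ε ^ 2 := lt_of_le_of_lt hw hδε2
    have := (hP q).2.2 hv' hw' h2
    rw [this]
  -- the image of `A` is the open set `{d < δ}`
  set N : Set (M × M) := {p | g.edist hg p.1 p.2 < ENNReal.ofReal δ} with hN
  have hNo : IsOpen N := isOpen_lt (PseudoRiemannianMetric.continuous_edist hg) continuous_const
  have hGA : G '' A = N := by
    refine Subset.antisymm ?_ fun p hp ↦ ?_
    · rintro _ ⟨v, hv, rfl⟩
      show g.edist hg v.proj (expMap cov v.proj v.2) < ENNReal.ofReal δ
      rw [hdist v (lt_trans hv hδε2), ENNReal.ofReal_lt_ofReal_iff hδpos, Real.sqrt_lt' hδpos]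
      exact hv
    · obtain ⟨x, y⟩ := p
      have hp' : g.edist hg x y < ENNReal.ofReal ε :=
        lt_of_lt_of_le hp (ENNReal.ofReal_le_ofReal hδε.le)
      obtain ⟨v, hvε, hvy⟩ := (hP x).2.1 y hp'
      have hd : g.edist hg x y = ENNReal.ofReal (Real.sqrt (g.val x v v)) := by
        rw [← hvy]; exact hdist ⟨x, v⟩ hvε
      have hlt : g.val x v v < δ ^ 2 := by
        have h1 : ENNReal.ofReal (Real.sqrt (g.val x v v)) < ENNReal.ofReal δ := hd ▸ hp
        rw [ENNReal.ofReal_lt_ofReal_iff hδpos, Real.sqrt_lt' hδpos] at h1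
        exact h1
      exact ⟨⟨x, v⟩, hlt, Prod.ext rfl hvy⟩
  -- `G` restricted to `A` is an open map
  have hopen : IsOpenMap (A.restrict G) := by
    haveI : CompactSpace K := isCompact_iff_compactSpace.1 hKc
    have hemb : IsClosedEmbedding (K.restrict G) :=
      (hGc.comp continuous_subtype_val).isClosedEmbedding hinjK.injective
    have hind : IsInducing (A.restrict G) :=
      hemb.isInducing.comp (Topology.IsEmbedding.inclusion hAK).isInducing
    refine hind.isOpenMap ?_
    rw [range_restrict, hGA]
    exact hNo
  have hinjA : InjOn G A := hinjK.mono hAK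
  set eqv := hinjA.toPartialEquiv G A with heqv
  have hsrc : eqv.source = A := rfl
  refine ⟨OpenPartialHomeomorph.ofContinuousOpenRestrict eqv hGc.continuousOn hopen hAo,
    fun v ↦ rfl, fun x ↦ ?_, fun v hv ↦ ?_, fun v hv t ht ↦ ?_⟩
  · -- the zero section lies in the source
    show g.val x (0 : TangentSpace I x) 0 < δ ^ 2
    have h0 : g.val x (0 : TangentSpace I x) 0 = 0 := by
      simp only [map_zero]
    rw [h0]
    positivity
  · -- on the source, `exp v = π v ↔ v = 0`
    have hvA : g.val v.proj v.2 v.2 < δ ^ 2 := hv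
    refine ⟨fun h ↦ ?_, fun h ↦ ?_⟩
    · by_contra hne
      have hpos : 0 < g.val v.proj v.2 v.2 := hg v.proj v.2 hne
      have hd := hdist v (lt_trans hvA hδε2)
      rw [h, PseudoRiemannianMetric.edist_self] at hd
      have h0 : Real.sqrt (g.val v.proj v.2 v.2) = 0 := by
        have := ENNReal.ofReal_eq_zero.1 hd.symm
        exact le_antisymm this (Real.sqrt_nonneg _)
      rw [Real.sqrt_eq_zero hpos.le] at h0
      exact hpos.ne' h0
    · obtain ⟨q, w⟩ := v
      change w = 0 at h
      subst h
      exact expMap_zero (cov := cov) q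
  · -- fibrewise star-shaped
    have hvA : g.val v.proj v.2 v.2 < δ ^ 2 := hv
    show g.val v.proj (t • v.2) (t • v.2) < δ ^ 2
    have hval : g.val v.proj (t • v.2) (t • v.2) = t * t * g.val v.proj v.2 v.2 := by
      simp only [map_smul, FunLike.coe_smul, Pi.smul_apply, smul_eq_mul]
      ring
    rw [hval]
    have ht2 : t * t ≤ 1 := by
      have h1 : |t| * |t| ≤ 1 * 1 := mul_le_mul ht ht (abs_nonneg t) zero_le_one
      rw [abs_mul_abs_self, one_mul] at h1
      exact h1
    have hnn : 0 ≤ g.val v.proj v.2 v.2 := by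
      by_cases h0 : v.2 = 0
      · obtain ⟨q, w⟩ := v
        change w = 0 at h0
        subst h0
        simp only [map_zero, le_refl]
      · exact (hg v.proj v.2 h0).le
    calc t * t * g.val v.proj v.2 v.2 ≤ 1 * g.val v.proj v.2 v.2 :=
          mul_le_mul_of_nonneg_right ht2 hnn
      _ < δ ^ 2 := by rw [one_mul]; exact hvA

end Compact

end Literature.Geometry.Riemannian
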